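import Summits.QuantumFields.YangMills.Theorems.FluctuationComparisonRegPrIntLS2BetaPairingTangentSplit
import Summits.QuantumFields.YangMills.Theorems.FluctuationComparisonRegPrIntLS2BetaStrataOfLetters
import HarnessLib

/-!
# S2β ∕ GAP♯∘ strata residue (H′) — THE GAUGED PAIRING LETTER (F♮) FROM ONE ANALYTIC LETTER: (F♮) ⟸ «CRIT♮» ∧ (BKG), with the tangent
# split (T♮) a THEOREM (✓`…S2BetaPairingTangentSplit.tangentSplit`)

Cell `ym3-torus` (YM ladder rung R3 = continuum `SU(2)` Yang–Mills on the three-torus — a RUNG: NOT d = 4, NOT infinite volume,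
NOT a mass gap, NOT Clay).  Width seat «width 16» `ym3-torus-px16` (gen 21), FREE px helper on crux `stmt-QuantumFields-20520`
(`FluctuationComparisonRegPrIntL`), count-neutral, DEFINITION-FREE, default heartbeats.

WHAT.  The letter of record (F♮) «pairing, plain distance» of ✓`…S2BetaStrataOfGaugedLetters` (RULING №88) —
`−LIN(U;U₀) ≤ c·N⁻²·d²(U,U₀) + ¼·REL(U;U₀)` at every argmin ∕ field pair, `N⁻² := ((F.L : ℝ)⁻¹)^(2(K−J))`, `d² := Σ_ℓ dist1(U ℓ·(U₀ ℓ)⁻¹)²` —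
is derived, prefix threaded VERBATIM and stratum guard `G` arbitrary, from TWO hypotheses whose analytic objects are PINNED (no `∃` over maps):
* «CRIT♮» (CONSTRAINED CRITICALITY, PAIR FORM): same prefix, then `∃ γ₁ > 0, ∃ C_c ≥ 0, ∀ F γ … ∀ U₀ ∈ argmin, ∀ U ∈ fibre ∩ histGood,`
  `|DA(U₀)[ξ(U,U₀)]| ≤ C_c·θ_J·(N⁻²·d²(U,U₀) + REL(U;U₀))` (`θ_J := θBal(J)`), where `DA(U₀)[ξ]` is the EXPLICIT first variation of the
  Wilson action at `U₀` in the right-invariant chart (✓`…PairingTangentSplit` §5: `Σ_p ⟪imVec q(U₀∂p), Ad_{T₁}ξ_{ℓ₁} + Ad_{T₂}ξ_{ℓ₂} − Ad_{T₃}ξ_{ℓ₃} − ξ_{ℓ₄}⟫`,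
  `ξ_ℓ := imVec q(U ℓ·(U₀ ℓ)⁻¹)`) — UV3-NODE §75.2 (c)–(d): at the interior regular argmin `DA(U₀) = λ∘DM(U₀)` (multiplier form), on the fibre
  `DM(U₀)[ξ] = −M_{≥2}(ξ)` is second order, `|λ|` carries the window's regularity; HOW the smallness is split between `λ` and the second-order
  fibre defect (the {CRIT-m♮, MULT♮, AVG₂♮} of §75.8 (3)) is INTERNAL to this letter — the `REL` slack admits rough (tower-adjacent,
  non-commuting) fibre directions where no `N`-gain is available, the `N⁻²·d²` term the smooth ones;
* (BKG): same prefix, then `∃ γ₁ > 0, ∃ C₁ ≥ 0, ∀ F γ … ∀ U₀ ∈ argmin, ∀ p, dist1 U₀∂p ≤ C₁·θ_J·N⁻²` — print Thm 1 (9) at the datum's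
  regularity (px5 g22 ✓∕⧗`…S2BetaBackgroundLetterOfThm1Pair`: from the Thm-1 pair letter; zero-hypothesis for `L ≥ 5`).
★★★ `pairingLetter_of_critPair (G) (hCrit) (hBkg)` : (F♮) with guard `G`, VERBATIM.  PROOF: `|LIN| ≤ |LIN − DA ξ| + |DA ξ| ≤ 20d·θ₀·d² + C_c·θ_J·(N⁻²d² + REL)`
(✓`tangentSplit` with `θ₀ := C₁θ_J N⁻²`) `≤ θ_J·((20dC₁ + C_c)·N⁻²d² + C_c·REL) ≤ c·N⁻²d² + ¼·REL` once `θ_J ≤ min(c, ¼)∕(20dC₁ + C_c + 1)`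
(lit ✓`exists_gamma_forall_θBal_le`, ✓`θBal_pos`).

HONEST SCOPE.  A DOOR: «CRIT♮» and (BKG) are HYPOTHESES (UV3-NODE §75.4∕§75.8: CRIT-m M + MULT M unprinted-as-stated + AVG₂ S∕M inside «CRIT♮»;
BKG = print Thm 1 (9), 19200-class); (T♮) is a theorem; nothing of Bałaban's analysis is asserted or proved; (F♮), (D♮), `hIrr`, `hA`, GAP♯∘
(`stub_uniformFibreGapOrbit`), S2β, the five registered stubs of `Lines/semiclassical_s2beta.lean` (3732b7df), crux 20520, 19936, 19200 and
`YM3TorusSU2` are NOT proved; no registered stub is closed; the Yang–Mills mass gap is NOT proved.  Sorry-free, axioms standard.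

References: T. Bałaban, CMP **102** (1985) 277–309 [Balaban1985Variational] (Thm 1 (8)–(10) p.279; (34) p.283; (142) p.299);
CMP **109** (1987) 249–301 [Balaban1987RG1] ((0.21)–(0.22) p.256: the one-step critical orbit); CMP **102** (1985) 255–275 [Balaban1985UV3] ((7) p.257).
-/

set_option autoImplicit false

noncomputable section

open Set Function
open scoped Matrix.Norms.L2Operator RealInnerProductSpace
open Literature.MathematicalPhysics.QuantumLattice (su2Quat)
open Literature.MathematicalPhysics.QuantumFieldTheory.Balaban1983to89
open Literature.MathematicalPhysics.QuantumFieldTheory.Balaban1983to89.T4Continuum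
open Literature.MathematicalPhysics.QuantumFieldTheory.Balaban1983to89.T3ContinuumYM3Torus
open Literature.MathematicalPhysics.QuantumFieldTheory.Balaban1983to89.T3UnitLawDensityEML (ℰp)
open Literature.MathematicalPhysics.QuantumFieldTheory.Balaban1983to89.T3UnitScaleTilt
open Literature.MathematicalPhysics.QuantumFieldTheory.Balaban1983to89.T3TiltDescent
open Literature.MathematicalPhysics.QuantumFieldTheory.Balaban1983to89.T3Thresholds (exists_gamma_forall_θBal_le)
open Literature.MathematicalPhysics.QuantumFieldTheory.Balaban1983to89.T3MinimiserStabilityReduction (θBal_pos)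
open Literature.MathematicalPhysics.QuantumFieldTheory.Balaban1983to89.T3ConstrainedMinimiser (fibre)
open Literature.MathematicalPhysics.QuantumFieldTheory.Balaban1983to89.T3PrintedRegularMinimiser
open Literature.MathematicalPhysics.QuantumFieldTheory.Balaban1983to89.T3PrintedRegularOrbits
open Literature.MathematicalPhysics.QuantumFieldTheory.Balaban1983to89.T4ExpWindowSmallField (imVec)
open Literature.MathematicalPhysics.QuantumFieldTheory.Balaban1983to89.B15Prop1ChartSU2 (adSU2)
open Summit.QuantumFields.YangMills.Theorems.FluctuationComparisonRegPrIntLS2BetaPairingTangentSplit (tangentSplit)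

namespace Summit.QuantumFields.YangMills.Theorems.FluctuationComparisonRegPrIntLS2BetaPairingOfTangentLetters

/-! ## §1 The real-variable core -/

/-- **THE ALGEBRA OF THE DOOR**: `|LIN − a| ≤ C_T·θ₀·S`, `|a| ≤ C_c·θ·(N₂·S + R)`, `θ₀ ≤ C₁·θ·N₂`, `(C_T·C₁ + C_c)·θ ≤ c`, `C_c·θ ≤ ¼`,
`S, R, N₂, C_T ≥ 0` ⟹ `−LIN ≤ c·(N₂·S) + ¼·R`. [folklore] -/
theorem neg_lin_le_of_critPair {LIN a S R θ₀ θ N₂ C_T C_c C₁ c : ℝ}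
    (hS : 0 ≤ S) (hR : 0 ≤ R) (hN₂ : 0 ≤ N₂) (hCT : 0 ≤ C_T)
    (hT : |LIN - a| ≤ C_T * θ₀ * S) (ha : |a| ≤ C_c * θ * (N₂ * S + R)) (hθ₀ : θ₀ ≤ C₁ * θ * N₂)
    (hc : (C_T * C₁ + C_c) * θ ≤ c) (hq : C_c * θ ≤ 1 / 4) :
    -LIN ≤ c * (N₂ * S) + 1 / 4 * R := by
  have h1 : -LIN ≤ |a| + C_T * θ₀ * S := by
    have h := (abs_le.mp hT).1
    have ha' := neg_abs_le a
    linarith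
  have h3 : C_T * θ₀ * S ≤ C_T * (C₁ * θ * N₂) * S := mul_le_mul_of_nonneg_right (mul_le_mul_of_nonneg_left hθ₀ hCT) hS
  have h4 : (C_T * C₁ + C_c) * θ * (N₂ * S) ≤ c * (N₂ * S) := mul_le_mul_of_nonneg_right hc (mul_nonneg hN₂ hS)
  have h5 : C_c * θ * R ≤ 1 / 4 * R := mul_le_mul_of_nonneg_right hq hR
  nlinarith

/-! ## §2 The door: (F♮) from «CRIT♮» and (BKG), arbitrary stratum guard -/

/-- ★★★ **(F♮) «PAIRING, PLAIN DISTANCE» FROM CONSTRAINED CRITICALITY IN PAIR FORM AND THE BACKGROUND LETTER.**  Conclusion = the (F♮) input of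
✓`…S2BetaStrataOfGaugedLetters.gapStratum_of_gaugedLetters` VERBATIM (guard `G`).  Hypotheses: «CRIT♮» `|DA(U₀)[ξ(U,U₀)]| ≤ C_c·θ_J·(N⁻²·d² + REL)`
with `DA(U₀)` the EXPLICIT first variation of ✓`…PairingTangentSplit`, and (BKG) `dist1 U₀∂p ≤ C₁·θ_J·N⁻²`; the tangent split (T♮) is ✓`tangentSplit`.
[cite: Balaban1985Variational, Thm 1 (8)-(10) p.279, (34) p.283; Balaban1987RG1, (0.21)-(0.22) p.256; Balaban1985UV3, (7) p.257] -/
theorem pairingLetter_of_critPair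
    (G : (F : T3Family) → (J : ℕ) → GaugeField (F.P J) 0 (Matrix.specialUnitaryGroup (Fin 2) ℂ) → Prop)
    (hCrit : ∀ (L : ℕ), ∃ c₀ : ℝ, 0 < c₀ ∧ c₀ ≤ 1 ∧ ∀ (cw : ℝ), 0 < cw → cw ≤ c₀ → ∃ pS : ℝ, ∀ (b₀ p₀ : ℝ), 0 < b₀ → pS ≤ p₀ → 0 < p₀ → ∃ ε₁ : ℝ, 0 < ε₁ ∧ ∀ (ε₀ : ℝ), 0 < ε₀ → ε₀ ≤ ε₁ →
    ∃ γ₁ : ℝ, 0 < γ₁ ∧ ∃ C_c : ℝ, 0 ≤ C_c ∧ ∀ (F : T3Family) (γ : ℝ), F.L = L → 0 < γ → γ ≤ γ₁ →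
      ∀ (J K : ℕ) (hJK : J ≤ K) (V : GaugeField (F.P J) 0 (Matrix.specialUnitaryGroup (Fin 2) ℂ)), PlaqSmall (θBal F.L γ (cw * b₀) p₀ J) V →
        G F J V →
        ∀ U₀ ∈ {U' : GaugeField (F.P K) 0 (Matrix.specialUnitaryGroup (Fin 2) ℂ) | U' ∈ fibre F ℰp J K hJK V ∧ U' ∈ histGood F ℰp (θBal F.L γ b₀ p₀) K J ∧
            wilsonAction4 U' = minActionRegPr F J K hJK ε₀ V},
        ∀ U ∈ fibre F ℰp J K hJK V, U ∈ histGood F ℰp (θBal F.L γ b₀ p₀) K J →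
          |(∑ p : Plaq (F.P K) 0, inner ℝ (imVec (su2Quat (GaugeField.plaqHol U₀ p)))
              (adSU2 (GaugeField.plaqHol U₀ p)⁻¹ (imVec (su2Quat (U ⟨p.src, p.μ⟩ * (U₀ ⟨p.src, p.μ⟩)⁻¹))) +
                adSU2 ((GaugeField.plaqHol U₀ p)⁻¹ * U₀ ⟨p.src, p.μ⟩) (imVec (su2Quat (U ⟨p.src.shift p.μ, p.ν⟩ * (U₀ ⟨p.src.shift p.μ, p.ν⟩)⁻¹))) -
                adSU2 ((GaugeField.plaqHol U₀ p)⁻¹ * U₀ ⟨p.src, p.μ⟩ * U₀ ⟨p.src.shift p.μ, p.ν⟩ * (U₀ ⟨p.src.shift p.ν, p.μ⟩)⁻¹)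
                  (imVec (su2Quat (U ⟨p.src.shift p.ν, p.μ⟩ * (U₀ ⟨p.src.shift p.ν, p.μ⟩)⁻¹))) -
                imVec (su2Quat (U ⟨p.src, p.ν⟩ * (U₀ ⟨p.src, p.ν⟩)⁻¹))))| ≤
            C_c * θBal F.L γ b₀ p₀ J * (((F.L : ℝ)⁻¹) ^ (2 * (K - J)) * ∑ ℓ : PBond (F.P K) 0, dist1 (U ℓ * (U₀ ℓ)⁻¹) ^ 2 +
              ∑ p : Plaq (F.P K) 0, (1 - reTr ((GaugeField.plaqHol U₀ p)⁻¹ * GaugeField.plaqHol U p))))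
    (hBkg : ∀ (L : ℕ), ∃ c₀ : ℝ, 0 < c₀ ∧ c₀ ≤ 1 ∧ ∀ (cw : ℝ), 0 < cw → cw ≤ c₀ → ∃ pS : ℝ, ∀ (b₀ p₀ : ℝ), 0 < b₀ → pS ≤ p₀ → 0 < p₀ → ∃ ε₁ : ℝ, 0 < ε₁ ∧ ∀ (ε₀ : ℝ), 0 < ε₀ → ε₀ ≤ ε₁ →
    ∃ γ₁ : ℝ, 0 < γ₁ ∧ ∃ C₁ : ℝ, 0 ≤ C₁ ∧ ∀ (F : T3Family) (γ : ℝ), F.L = L → 0 < γ → γ ≤ γ₁ →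
      ∀ (J K : ℕ) (hJK : J ≤ K) (V : GaugeField (F.P J) 0 (Matrix.specialUnitaryGroup (Fin 2) ℂ)), PlaqSmall (θBal F.L γ (cw * b₀) p₀ J) V →
        G F J V →
        ∀ U₀ ∈ {U' : GaugeField (F.P K) 0 (Matrix.specialUnitaryGroup (Fin 2) ℂ) | U' ∈ fibre F ℰp J K hJK V ∧ U' ∈ histGood F ℰp (θBal F.L γ b₀ p₀) K J ∧
            wilsonAction4 U' = minActionRegPr F J K hJK ε₀ V},
        ∀ p : Plaq (F.P K) 0, dist1 (GaugeField.plaqHol U₀ p) ≤ C₁ * θBal F.L γ b₀ p₀ J * ((F.L : ℝ)⁻¹) ^ (2 * (K - J))) :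
    ∀ (L : ℕ), ∃ c₀ : ℝ, 0 < c₀ ∧ c₀ ≤ 1 ∧ ∀ (cw : ℝ), 0 < cw → cw ≤ c₀ → ∃ pS : ℝ, ∀ (b₀ p₀ : ℝ), 0 < b₀ → pS ≤ p₀ → 0 < p₀ → ∃ ε₁ : ℝ, 0 < ε₁ ∧ ∀ (ε₀ : ℝ), 0 < ε₀ → ε₀ ≤ ε₁ →
    ∀ (c : ℝ), 0 < c → ∃ γ₁ : ℝ, 0 < γ₁ ∧ ∀ (F : T3Family) (γ : ℝ), F.L = L → 0 < γ → γ ≤ γ₁ →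
      ∀ (J K : ℕ) (hJK : J ≤ K) (V : GaugeField (F.P J) 0 (Matrix.specialUnitaryGroup (Fin 2) ℂ)), PlaqSmall (θBal F.L γ (cw * b₀) p₀ J) V →
        G F J V →
        ∀ U₀ ∈ {U' : GaugeField (F.P K) 0 (Matrix.specialUnitaryGroup (Fin 2) ℂ) | U' ∈ fibre F ℰp J K hJK V ∧ U' ∈ histGood F ℰp (θBal F.L γ b₀ p₀) K J ∧
            wilsonAction4 U' = minActionRegPr F J K hJK ε₀ V},
        ∀ U ∈ fibre F ℰp J K hJK V, U ∈ histGood F ℰp (θBal F.L γ b₀ p₀) K J →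
          -(∑ p : Plaq (F.P K) 0,
              inner ℝ (imVec (su2Quat (GaugeField.plaqHol U₀ p))) (imVec (su2Quat ((GaugeField.plaqHol U₀ p)⁻¹ * GaugeField.plaqHol U p))))
            ≤ c * (((F.L : ℝ)⁻¹) ^ (2 * (K - J)) * ∑ ℓ : PBond (F.P K) 0, dist1 (U ℓ * (U₀ ℓ)⁻¹) ^ 2) +
              1 / 4 * ∑ p : Plaq (F.P K) 0, (1 - reTr ((GaugeField.plaqHol U₀ p)⁻¹ * GaugeField.plaqHol U p)) := by
  intro L
  obtain ⟨c₁, hc₁, hc₁1, H1⟩ := hCrit L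
  obtain ⟨c₂, hc₂, -, H2⟩ := hBkg L
  refine ⟨min c₁ c₂, lt_min hc₁ hc₂, (min_le_left _ _).trans hc₁1, ?_⟩
  intro cw hcw hcwle
  obtain ⟨pS₁, H1⟩ := H1 cw hcw (hcwle.trans (min_le_left _ _))
  obtain ⟨pS₂, H2⟩ := H2 cw hcw (hcwle.trans (min_le_right _ _))
  refine ⟨max pS₁ pS₂, ?_⟩
  intro b₀ p₀ hb hpS hp
  obtain ⟨e₁, he₁, H1⟩ := H1 b₀ p₀ hb ((le_max_left _ _).trans hpS) hp
  obtain ⟨e₂, he₂, H2⟩ := H2 b₀ p₀ hb ((le_max_right _ _).trans hpS) hp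
  refine ⟨min e₁ e₂, lt_min he₁ he₂, ?_⟩
  intro ε₀ hε₀ hε₀le
  obtain ⟨γA, hγA, C_c, hCc, H1⟩ := H1 ε₀ hε₀ (hε₀le.trans (min_le_left _ _))
  obtain ⟨γB, hγB, C₁, hC₁, H2⟩ := H2 ε₀ hε₀ (hε₀le.trans (min_le_right _ _))
  intro c hc
  -- `γ` small enough that `θBal(J) ≤ min c ¼ ∕ (60·C₁ + C_c + 1)` (`d = 3` for the family, ✓`T3Family.P_d`)
  obtain ⟨γc, hγc, hγc1, hθ⟩ := exists_gamma_forall_θBal_le (b₀ := b₀) (p₀ := p₀) hb hp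
    (σ := min c (1 / 4) / (20 * 3 * C₁ + C_c + 1)) (by positivity)
  refine ⟨min γA (min γB γc), lt_min hγA (lt_min hγB hγc), ?_⟩
  intro F γ hFL hγ hγle J K hJK V hV hG U₀ hU₀ U hU hUg
  have ha := H1 F γ hFL hγ (hγle.trans (min_le_left _ _)) J K hJK V hV hG U₀ hU₀ U hU hUg
  have hbkg := H2 F γ hFL hγ (hγle.trans ((min_le_right _ _).trans (min_le_left _ _))) J K hJK V hV hG U₀ hU₀
  have hθJ := hθ F.L F.hL.2.le γ hγ (hγle.trans ((min_le_right _ _).trans (min_le_right _ _))) J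
  have hγ1 : γ ≤ 1 := (hγle.trans ((min_le_right _ _).trans (min_le_right _ _))).trans hγc1
  have hθJ0 : 0 ≤ θBal F.L γ b₀ p₀ J := (θBal_pos F.hL.2.le hγ hγ1 hb p₀ J).le
  have hN₂ : (0 : ℝ) ≤ ((F.L : ℝ)⁻¹) ^ (2 * (K - J)) := pow_nonneg (inv_nonneg.mpr (Nat.cast_nonneg _)) _
  have hθ₀0 : 0 ≤ C₁ * θBal F.L γ b₀ p₀ J * ((F.L : ℝ)⁻¹) ^ (2 * (K - J)) := mul_nonneg (mul_nonneg hC₁ hθJ0) hN₂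
  have hT := tangentSplit U U₀ hθ₀0 hbkg
  beta_reduce at hT
  have hd : ((F.P K).d : ℝ) = 3 := by exact_mod_cast T3Family.P_d F K
  rw [hd] at hT
  have hS : (0 : ℝ) ≤ ∑ ℓ : PBond (F.P K) 0, dist1 (U ℓ * (U₀ ℓ)⁻¹) ^ 2 := Finset.sum_nonneg fun _ _ => sq_nonneg _
  have hREL : (0 : ℝ) ≤ ∑ p : Plaq (F.P K) 0, (1 - reTr ((GaugeField.plaqHol U₀ p)⁻¹ * GaugeField.plaqHol U p)) :=
    Finset.sum_nonneg fun p _ => by linarith [GaugeGroup.reTr_le_one ((GaugeField.plaqHol U₀ p)⁻¹ * GaugeField.plaqHol U p)]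
  have hpos : 0 < 20 * 3 * C₁ + C_c + 1 := by positivity
  have hσ : (20 * 3 * C₁ + C_c + 1) * θBal F.L γ b₀ p₀ J ≤ min c (1 / 4) := by
    have h1 := mul_le_mul_of_nonneg_left hθJ hpos.le
    rwa [mul_div_cancel₀ _ hpos.ne'] at h1
  have hc' : (20 * 3 * C₁ + C_c) * θBal F.L γ b₀ p₀ J ≤ c := by
    have := min_le_left c (1 / 4); nlinarith
  have hq : C_c * θBal F.L γ b₀ p₀ J ≤ 1 / 4 := by
    have := min_le_right c (1 / 4); nlinarith
  exact neg_lin_le_of_critPair hS hREL hN₂ (by norm_num) hT ha le_rfl hc' hq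

end Summit.QuantumFields.YangMills.Theorems.FluctuationComparisonRegPrIntLS2BetaPairingOfTangentLetters

end
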